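import Mathlib
import Summits.MatrixMultiplication.MatrixMultiplication.Theorems.HiddenToeplitzCornersHiddenCornerLemmaRStein

/-!
# Monomial containments: shift equivariance of a killing class member
# (hidden-corner lemma, crux stmt-MatrixMultiplication-10752)

Support file for crux item `stmt-MatrixMultiplication-10752`
(`Summit.MatrixMultiplication.MatrixMultiplication.Theses.HiddenToeplitzCorners.HiddenCornerLemmaR`),
line `atkinson-lloyd-core-split`, lemma L3 of the monomial theorem: the registered stubs
`hclR_kills_shiftUp` and `hclR_kills_monomial_shiftDown`.

Model `ℂ^N = ℂ[x]/(x^N)`, `e_n ↔ x^n`; `Z` is the lower shift (multiplication by `x`, written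
verbatim as in the crux, `Z i j = [i = j + 1]`), `Zᵀ` divides by `x` dropping the constant term.
A class member is `K = Σ_k L(g_k) U(h_k)` with `L(g_k) = Σ_i G₀ i k • Z^i` (commutes with `Z`) and
`U(h_k) = Σ_i H k i • (Zᵀ)^i` (commutes with `Zᵀ`); `G` is the column span of `G₀`, and
`L(g_k) e₀ = g_k` is column `k` of `G₀`.

* `hclR_kc_displacement` — STEIN DISPLACEMENT of a class member: since `Z Zᵀ = 1 - e₀ e₀ᵀ`,
  `K u - Z K Zᵀ u = Σ_k (U(h_k) u)₀ • g_k ∈ G` for every `u`.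
* `hclR_kc_shiftUp_step` — `x`-EQUIVARIANCE: `Zᵀ Z = 1 - e_{N-1} e_{N-1}ᵀ`, so for `y` with last
  coordinate `0`, `K (Z y) = Z (K y) + γ` with `γ ∈ G`.
* `hclR_kc_shiftDown_step` — `δ`-EQUIVARIANCE: `K (Zᵀ u) = Zᵀ (K u) - Zᵀ γ + (K (Zᵀ u))_{N-1} • e_{N-1}`.
* `hclR_kills_shiftUp` — if `K e = 0`, `deg e ≤ d` and `d + j < N`, then
  `K (Z^j e) ∈ span {Z^i g_k : i < j}` (induction on `j`; each `Z^i e`, `i < j`, has last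
  coordinate `0`).
* `hclR_kills_monomial_shiftDown` — if `K e_{n_d} = 0` and `n_t + j = n_d`, then
  `K e_{n_t} ∈ span ({(Zᵀ)^i g_k : 1 ≤ i ≤ j} ∪ {e_n : N ≤ n + j})` (downward induction, using
  `Zᵀ e_{n+1} = e_n`).

Elementary linear algebra over `ℂ`; nothing beyond Mathlib and the Stein toolkit
(`…HiddenCornerLemmaRStein`). [folklore]
-/

-- D-0017: the single-problem layout `Summits/<S>/<S>/…` duplicates a namespace segment by design.
set_option linter.dupNamespace false

namespace Summit.MatrixMultiplication.MatrixMultiplication.Theorems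

open Matrix BigOperators Finset

section abstractShift

variable {n p : ℕ}

/-- **Stein displacement of a class member (abstract form).**  If `K v = Σ_k L_k (U_k v)`, every
`L_k` commutes with `Z`, every `U_k` commutes with `Zᵀ`, and `Z Zᵀ = 1 - e₀ e₀ᵀ`, then
`K u - Z K Zᵀ u = Σ_k (U_k u)₀ • L_k e₀`. -/
theorem hclR_kc_displacement (Z K : Matrix (Fin (n + 1)) (Fin (n + 1)) ℂ)
    (L U : Fin p → Matrix (Fin (n + 1)) (Fin (n + 1)) ℂ)
    (hK : ∀ v, K *ᵥ v = ∑ k, L k *ᵥ (U k *ᵥ v))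
    (hL : ∀ k v, Z *ᵥ (L k *ᵥ v) = L k *ᵥ (Z *ᵥ v))
    (hU : ∀ k v, U k *ᵥ (Zᵀ *ᵥ v) = Zᵀ *ᵥ (U k *ᵥ v))
    (hZZt : ∀ v : Fin (n + 1) → ℂ, Z *ᵥ (Zᵀ *ᵥ v) = v - v 0 • Pi.single 0 1)
    (u : Fin (n + 1) → ℂ) :
    K *ᵥ u - Z *ᵥ (K *ᵥ (Zᵀ *ᵥ u)) = ∑ k, (U k *ᵥ u) 0 • (L k *ᵥ Pi.single 0 1) := by
  rw [hK, hK, Matrix.mulVec_sum]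
  have h : ∀ k, Z *ᵥ (L k *ᵥ (U k *ᵥ (Zᵀ *ᵥ u))) =
      L k *ᵥ (U k *ᵥ u) - (U k *ᵥ u) 0 • (L k *ᵥ Pi.single 0 1) := by
    intro k
    rw [hU, hL, hZZt, Matrix.mulVec_sub, Matrix.mulVec_smul]
  simp only [h, Finset.sum_sub_distrib, sub_sub_cancel]

/-- **`x`-equivariance (abstract form).**  Under the hypotheses of `hclR_kc_displacement` and
`Zᵀ Z = 1 - e_{N-1} e_{N-1}ᵀ`: if the last coordinate of `y` vanishes then
`K (Z y) = Z (K y) + Σ_k (U_k (Z y))₀ • L_k e₀`. -/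
theorem hclR_kc_shiftUp_step (Z K : Matrix (Fin (n + 1)) (Fin (n + 1)) ℂ)
    (L U : Fin p → Matrix (Fin (n + 1)) (Fin (n + 1)) ℂ)
    (hK : ∀ v, K *ᵥ v = ∑ k, L k *ᵥ (U k *ᵥ v))
    (hL : ∀ k v, Z *ᵥ (L k *ᵥ v) = L k *ᵥ (Z *ᵥ v))
    (hU : ∀ k v, U k *ᵥ (Zᵀ *ᵥ v) = Zᵀ *ᵥ (U k *ᵥ v))
    (hZZt : ∀ v : Fin (n + 1) → ℂ, Z *ᵥ (Zᵀ *ᵥ v) = v - v 0 • Pi.single 0 1)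
    (hZtZ : ∀ v : Fin (n + 1) → ℂ,
      Zᵀ *ᵥ (Z *ᵥ v) = v - v (Fin.last n) • Pi.single (Fin.last n) 1)
    (y : Fin (n + 1) → ℂ) (hy : y (Fin.last n) = 0) :
    K *ᵥ (Z *ᵥ y) = Z *ᵥ (K *ᵥ y) + ∑ k, (U k *ᵥ (Z *ᵥ y)) 0 • (L k *ᵥ Pi.single 0 1) := by
  have h := hclR_kc_displacement Z K L U hK hL hU hZZt (Z *ᵥ y)
  rw [hZtZ, hy, zero_smul, sub_zero] at h
  rw [← h]
  abel

/-- **`δ`-equivariance (abstract form).**  Under the hypotheses of `hclR_kc_shiftUp_step`, for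
every `u`: `K (Zᵀ u) = Zᵀ (K u) - Σ_k (U_k u)₀ • Zᵀ (L_k e₀) + (K (Zᵀ u))_{N-1} • e_{N-1}`. -/
theorem hclR_kc_shiftDown_step (Z K : Matrix (Fin (n + 1)) (Fin (n + 1)) ℂ)
    (L U : Fin p → Matrix (Fin (n + 1)) (Fin (n + 1)) ℂ)
    (hK : ∀ v, K *ᵥ v = ∑ k, L k *ᵥ (U k *ᵥ v))
    (hL : ∀ k v, Z *ᵥ (L k *ᵥ v) = L k *ᵥ (Z *ᵥ v))
    (hU : ∀ k v, U k *ᵥ (Zᵀ *ᵥ v) = Zᵀ *ᵥ (U k *ᵥ v))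
    (hZZt : ∀ v : Fin (n + 1) → ℂ, Z *ᵥ (Zᵀ *ᵥ v) = v - v 0 • Pi.single 0 1)
    (hZtZ : ∀ v : Fin (n + 1) → ℂ,
      Zᵀ *ᵥ (Z *ᵥ v) = v - v (Fin.last n) • Pi.single (Fin.last n) 1)
    (u : Fin (n + 1) → ℂ) :
    K *ᵥ (Zᵀ *ᵥ u) = Zᵀ *ᵥ (K *ᵥ u) - ∑ k, (U k *ᵥ u) 0 • (Zᵀ *ᵥ (L k *ᵥ Pi.single 0 1)) +
      (K *ᵥ (Zᵀ *ᵥ u)) (Fin.last n) • Pi.single (Fin.last n) 1 := by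
  have h := hclR_kc_displacement Z K L U hK hL hU hZZt u
  have h2 := hZtZ (K *ᵥ (Zᵀ *ᵥ u))
  have h3 : Z *ᵥ (K *ᵥ (Zᵀ *ᵥ u)) =
      K *ᵥ u - ∑ k, (U k *ᵥ u) 0 • (L k *ᵥ Pi.single 0 1) := by
    rw [← h]; abel
  calc K *ᵥ (Zᵀ *ᵥ u)
      = Zᵀ *ᵥ (Z *ᵥ (K *ᵥ (Zᵀ *ᵥ u))) +
          (K *ᵥ (Zᵀ *ᵥ u)) (Fin.last n) • Pi.single (Fin.last n) 1 := by
        rw [h2, sub_add_cancel]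
    _ = _ := by
        rw [h3, Matrix.mulVec_sub, Matrix.mulVec_sum]
        simp only [Matrix.mulVec_smul]

end abstractShift

section shiftCalculus

variable {N : ℕ}

/-- A matrix commutes with every combination `Σ_i c_i • M^{f i}` of its own powers. -/
theorem hclR_kc_commute_sum_smul_pow {ι : Type*} (s : Finset ι) (M : Matrix (Fin N) (Fin N) ℂ)
    (c : ι → ℂ) (f : ι → ℕ) : Commute M (∑ i ∈ s, c i • M ^ f i) :=
  Commute.sum_right _ _ _ fun i _ => (Commute.self_pow M (f i)).smul_right (c i)

/-- Entries of `Z *ᵥ v`: the down-shift `(Z v)_i = v_{i-1}` (`0` for `i = 0`). -/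
theorem hclR_kc_shift_mulVec_apply (v : Fin N → ℂ) (i : Fin N) :
    ((Matrix.of fun i j : Fin N => if (i : ℕ) = (j : ℕ) + 1 then (1 : ℂ) else 0) *ᵥ v) i =
      if h : 1 ≤ (i : ℕ) then v ⟨(i : ℕ) - 1, by omega⟩ else 0 := by
  have := hclR_shift_pow_mulVec 1 v i
  rwa [pow_one] at this

/-- Entries of `Zᵀ *ᵥ v`: the up-shift `(Zᵀ v)_m = v_{m+1}` (`0` for `m = N - 1`). -/
theorem hclR_kc_shiftT_mulVec_apply (v : Fin N → ℂ) (m : Fin N) :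
    ((Matrix.of fun i j : Fin N => if (i : ℕ) = (j : ℕ) + 1 then (1 : ℂ) else 0)ᵀ *ᵥ v) m =
      if h : (m : ℕ) + 1 < N then v ⟨(m : ℕ) + 1, h⟩ else 0 := by
  have := hclR_shiftT_pow_mulVec 1 v m
  rwa [pow_one] at this

/-- `Zᵀ e_{i+1} = e_i`. -/
theorem hclR_kc_shiftT_mulVec_single_succ (i j : Fin N) (hij : (j : ℕ) = (i : ℕ) + 1) :
    (Matrix.of fun i j : Fin N => if (i : ℕ) = (j : ℕ) + 1 then (1 : ℂ) else 0)ᵀ *ᵥ Pi.single j 1 =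
      Pi.single i 1 := by
  ext m
  rw [hclR_kc_shiftT_mulVec_apply]
  by_cases h : (m : ℕ) + 1 < N
  · rw [dif_pos h]
    by_cases hm : m = i
    · subst hm
      have : (⟨(m : ℕ) + 1, h⟩ : Fin N) = j := Fin.ext (by simp only; omega)
      rw [this, Pi.single_eq_same, Pi.single_eq_same]
    · have : (⟨(m : ℕ) + 1, h⟩ : Fin N) ≠ j := fun h' => hm (Fin.ext (by
        have := congrArg Fin.val h'; simp only at this; omega))
      rw [Pi.single_eq_of_ne this, Pi.single_eq_of_ne hm]
  · rw [dif_neg h]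
    have hm : m ≠ i := fun h' => by subst h'; have := j.2; omega
    rw [Pi.single_eq_of_ne hm]

/-- `Zᵀ e_0 = 0`. -/
theorem hclR_kc_shiftT_mulVec_single_zero (j : Fin N) (hj : (j : ℕ) = 0) :
    (Matrix.of fun i j : Fin N => if (i : ℕ) = (j : ℕ) + 1 then (1 : ℂ) else 0)ᵀ *ᵥ Pi.single j 1 =
      0 := by
  ext m
  rw [hclR_kc_shiftT_mulVec_apply, Pi.zero_apply]
  by_cases h : (m : ℕ) + 1 < N
  · rw [dif_pos h]
    have : (⟨(m : ℕ) + 1, h⟩ : Fin N) ≠ j := fun h' => by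
      have := congrArg Fin.val h'; simp only at this; omega
    rw [Pi.single_eq_of_ne this]
  · rw [dif_neg h]

variable {n : ℕ}

/-- `Z Zᵀ = 1 - e₀ e₀ᵀ`: `Z (Zᵀ v) = v - v₀ • e₀`. -/
theorem hclR_kc_shift_shiftT_mulVec (v : Fin (n + 1) → ℂ) :
    (Matrix.of fun i j : Fin (n + 1) => if (i : ℕ) = (j : ℕ) + 1 then (1 : ℂ) else 0) *ᵥ
        ((Matrix.of fun i j : Fin (n + 1) => if (i : ℕ) = (j : ℕ) + 1 then (1 : ℂ) else 0)ᵀ *ᵥ v) =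
      v - v 0 • Pi.single 0 1 := by
  ext m
  rw [hclR_kc_shift_mulVec_apply, Pi.sub_apply, Pi.smul_apply, smul_eq_mul]
  by_cases hm : 1 ≤ (m : ℕ)
  · rw [dif_pos hm, hclR_kc_shiftT_mulVec_apply, dif_pos (by simp only; omega)]
    have h1 : (⟨(m : ℕ) - 1 + 1, by omega⟩ : Fin (n + 1)) = m := Fin.ext (by simp only; omega)
    have h2 : m ≠ 0 := fun h => by subst h; simp at hm
    rw [h1, Pi.single_eq_of_ne h2, mul_zero, sub_zero]
  · rw [dif_neg hm]
    have h2 : m = 0 := Fin.ext (by simp only [Fin.val_zero]; omega)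
    rw [h2, Pi.single_eq_same, mul_one, sub_self]

/-- `Zᵀ Z = 1 - e_{N-1} e_{N-1}ᵀ`: `Zᵀ (Z v) = v - v_{N-1} • e_{N-1}`. -/
theorem hclR_kc_shiftT_shift_mulVec (v : Fin (n + 1) → ℂ) :
    (Matrix.of fun i j : Fin (n + 1) => if (i : ℕ) = (j : ℕ) + 1 then (1 : ℂ) else 0)ᵀ *ᵥ
        ((Matrix.of fun i j : Fin (n + 1) => if (i : ℕ) = (j : ℕ) + 1 then (1 : ℂ) else 0) *ᵥ v) =
      v - v (Fin.last n) • Pi.single (Fin.last n) 1 := by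
  ext m
  rw [hclR_kc_shiftT_mulVec_apply, Pi.sub_apply, Pi.smul_apply, smul_eq_mul]
  by_cases hm : (m : ℕ) + 1 < n + 1
  · rw [dif_pos hm, hclR_kc_shift_mulVec_apply, dif_pos (by simp only; omega)]
    have h1 : (⟨(m : ℕ) + 1 - 1, by omega⟩ : Fin (n + 1)) = m := Fin.ext (by simp only; omega)
    have h2 : m ≠ Fin.last n := fun h => by subst h; simp at hm
    rw [h1, Pi.single_eq_of_ne h2, mul_zero, sub_zero]
  · rw [dif_neg hm]
    have h2 : m = Fin.last n := Fin.ext (by simp only [Fin.val_last]; omega)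
    rw [h2, Pi.single_eq_same, mul_one, sub_self]

/-- `L(g_k) e₀ = g_k`: the lower Toeplitz operator of column `k` of `G₀` sends `e₀` to that column. -/
theorem hclR_kc_lowerToeplitz_mulVec_e0 {p : ℕ} (G₀ : Matrix (Fin (n + 1)) (Fin p) ℂ) (k : Fin p) :
    (∑ i : Fin (n + 1), G₀ i k •
        (Matrix.of fun i j : Fin (n + 1) => if (i : ℕ) = (j : ℕ) + 1 then (1 : ℂ) else 0) ^ (i : ℕ)) *ᵥ
      Pi.single 0 1 = fun m => G₀ m k := by
  rw [Matrix.mulVec_single_one]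
  ext m
  simp only [Matrix.col_apply, Matrix.sum_apply, Matrix.smul_apply, hclR_shift_pow_apply,
    smul_eq_mul, Fin.val_zero, zero_add, mul_ite, mul_one, mul_zero, Fin.val_inj,
    Finset.sum_ite_eq, Finset.mem_univ, if_true]

end shiftCalculus

/-- **`x`-equivariance of a killing class member (stub `hclR_kills_shiftUp`, lemma L3).**
`Z` is the lower shift written verbatim, `K = Σ_k L(g_k) U(h_k)` with
`L(g_k) = Σ_i G₀ i k • Z^i`, `U(h_k) = Σ_i H k i • (Zᵀ)^i`.  If `K e = 0`, `e` is supported in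
degrees `≤ d` and `d + j < N`, then `K (Z^j e) ∈ span {Z^i g_k : i < j, k}` (`g_k` = column `k` of
`G₀`).  Induction on `j` via `K (Z y) = Z (K y) + γ`, `γ ∈ G`, valid since `Z^i e` (`i < j`) has
vanishing last coordinate. -/
theorem hclR_kills_shiftUp : ∀ (N p d j : ℕ) (G₀ : Matrix (Fin N) (Fin p) ℂ) (H : Fin p → (Fin N → ℂ)) (e : Fin N → ℂ), (∀ n : Fin N, d < (n : ℕ) → e n = 0) → d + j < N → (∑ k : Fin p, ((∑ i : Fin N, G₀ i k • (Matrix.of fun i j : Fin N => if (i : ℕ) = (j : ℕ) + 1 then (1 : ℂ) else 0) ^ (i : ℕ)) * (∑ i : Fin N, H k i • (Matrix.of fun i j : Fin N => if (i : ℕ) = (j : ℕ) + 1 then (1 : ℂ) else 0)ᵀ ^ (i : ℕ)))) *ᵥ e = 0 → (∑ k : Fin p, ((∑ i : Fin N, G₀ i k • (Matrix.of fun i j : Fin N => if (i : ℕ) = (j : ℕ) + 1 then (1 : ℂ) else 0) ^ (i : ℕ)) * (∑ i : Fin N, H k i • (Matrix.of fun i j : Fin N => if (i : ℕ) = (j :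 ℕ) + 1 then (1 : ℂ) else 0)ᵀ ^ (i : ℕ)))) *ᵥ ((Matrix.of fun i j : Fin N => if (i : ℕ) = (j : ℕ) + 1 then (1 : ℂ) else 0) ^ j *ᵥ e) ∈ Submodule.span ℂ {w : Fin N → ℂ | ∃ (k : Fin p) (i : ℕ), i < j ∧ w = (Matrix.of fun i j : Fin N => if (i : ℕ) = (j : ℕ) + 1 then (1 : ℂ) else 0) ^ i *ᵥ (fun n => G₀ n k)} := by
  intro N p d j G₀ H e he hdj hKe
  cases N with
  | zero => exact absurd hdj (by omega)
  | succ n =>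
  set Z : Matrix (Fin (n + 1)) (Fin (n + 1)) ℂ :=
    Matrix.of fun i j : Fin (n + 1) => if (i : ℕ) = (j : ℕ) + 1 then (1 : ℂ) else 0 with hZ
  set K : Matrix (Fin (n + 1)) (Fin (n + 1)) ℂ :=
    ∑ k : Fin p, ((∑ i : Fin (n + 1), G₀ i k • Z ^ (i : ℕ)) *
      (∑ i : Fin (n + 1), H k i • Zᵀ ^ (i : ℕ))) with hK
  -- the abstract hypotheses
  have hKv : ∀ v, K *ᵥ v = ∑ k : Fin p, (∑ i : Fin (n + 1), G₀ i k • Z ^ (i : ℕ)) *ᵥ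
      ((∑ i : Fin (n + 1), H k i • Zᵀ ^ (i : ℕ)) *ᵥ v) := by
    intro v
    rw [hK, Matrix.sum_mulVec]
    simp only [Matrix.mulVec_mulVec]
  have hL : ∀ (k : Fin p) v, Z *ᵥ ((∑ i : Fin (n + 1), G₀ i k • Z ^ (i : ℕ)) *ᵥ v) =
      (∑ i : Fin (n + 1), G₀ i k • Z ^ (i : ℕ)) *ᵥ (Z *ᵥ v) := by
    intro k v
    rw [Matrix.mulVec_mulVec, Matrix.mulVec_mulVec,
      (hclR_kc_commute_sum_smul_pow Finset.univ Z (fun i => G₀ i k) (fun i => (i : ℕ))).eq]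
  have hU : ∀ (k : Fin p) v, (∑ i : Fin (n + 1), H k i • Zᵀ ^ (i : ℕ)) *ᵥ (Zᵀ *ᵥ v) =
      Zᵀ *ᵥ ((∑ i : Fin (n + 1), H k i • Zᵀ ^ (i : ℕ)) *ᵥ v) := by
    intro k v
    rw [Matrix.mulVec_mulVec, Matrix.mulVec_mulVec,
      (hclR_kc_commute_sum_smul_pow Finset.univ Zᵀ (fun i => H k i) (fun i => (i : ℕ))).eq]
  have hZZt : ∀ v : Fin (n + 1) → ℂ, Z *ᵥ (Zᵀ *ᵥ v) = v - v 0 • Pi.single 0 1 :=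
    hclR_kc_shift_shiftT_mulVec
  have hZtZ : ∀ v : Fin (n + 1) → ℂ,
      Zᵀ *ᵥ (Z *ᵥ v) = v - v (Fin.last n) • Pi.single (Fin.last n) 1 :=
    hclR_kc_shiftT_shift_mulVec
  induction j with
  | zero =>
    rw [pow_zero, Matrix.one_mulVec, hKe]
    exact Submodule.zero_mem _
  | succ j ih =>
    have hy : (Z ^ j *ᵥ e) (Fin.last n) = 0 := by
      rw [hclR_shift_pow_mulVec, dif_pos (by simp only [Fin.val_last]; omega)]
      exact he _ (by simp only [Fin.val_last]; omega)
    have hstep := hclR_kc_shiftUp_step Z K _ _ hKv hL hU hZZt hZtZ (Z ^ j *ᵥ e) hy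
    rw [pow_succ', ← Matrix.mulVec_mulVec, hstep]
    refine Submodule.add_mem _ ?_ ?_
    · have hle : Submodule.map (Matrix.mulVecLin Z)
          (Submodule.span ℂ {w : Fin (n + 1) → ℂ | ∃ (k : Fin p) (i : ℕ), i < j ∧
            w = Z ^ i *ᵥ (fun n => G₀ n k)}) ≤
          Submodule.span ℂ {w : Fin (n + 1) → ℂ | ∃ (k : Fin p) (i : ℕ), i < j + 1 ∧
            w = Z ^ i *ᵥ (fun n => G₀ n k)} := by
        rw [Submodule.map_span_le]
        rintro _ ⟨k, i, hi, rfl⟩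
        refine Submodule.subset_span ⟨k, i + 1, by omega, ?_⟩
        rw [Matrix.mulVecLin_apply, Matrix.mulVec_mulVec, ← pow_succ']
      exact hle (Submodule.mem_map_of_mem (ih (by omega)))
    · refine Submodule.sum_mem _ fun k _ => Submodule.smul_mem _ _ (Submodule.subset_span
        ⟨k, 0, Nat.succ_pos j, ?_⟩)
      rw [hclR_kc_lowerToeplitz_mulVec_e0, pow_zero, Matrix.one_mulVec]

/-- **`δ`-equivariance from a killed monomial (stub `hclR_kills_monomial_shiftDown`, lemma L3).**
With `Z`, `K = Σ_k L(g_k) U(h_k)` as in `hclR_kills_shiftUp`: if `K e_{n_d} = 0` and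
`n_t + j = n_d` (`j ≥ 1`), then
`K e_{n_t} ∈ span ({(Zᵀ)^i g_k : 1 ≤ i ≤ j, k} ∪ {e_n : N ≤ n + j})`.  Downward induction:
`Z K e_{n_t} = K e_{n_t + 1} - γ` (`γ ∈ G`, from `Zᵀ e_{n_t+1} = e_{n_t}` and the Stein
displacement), then apply `Zᵀ` using `Zᵀ Z = 1 - e_{N-1} e_{N-1}ᵀ`. -/
theorem hclR_kills_monomial_shiftDown : ∀ (N p j : ℕ) (G₀ : Matrix (Fin N) (Fin p) ℂ) (H : Fin p → (Fin N → ℂ)) (nd nt : Fin N), (nt : ℕ) + j = (nd : ℕ) → 1 ≤ j → (∑ k : Fin p, ((∑ i : Fin N, G₀ i k • (Matrix.of fun i j : Fin N => if (i : ℕ) = (j : ℕ) + 1 then (1 : ℂ) else 0) ^ (i : ℕ)) * (∑ i : Fin N, H k i • (Matrix.of fun i j : Fin N => if (i : ℕ) = (j : ℕ) + 1 then (1 : ℂ) else 0)ᵀ ^ (i : ℕ)))) *ᵥ (Pi.single nd 1) = 0 → (∑ k : Fin p, ((∑ i : Fin N, G₀ i k • (Matrix.of fun i j : Fin N => if (i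 : ℕ) = (j : ℕ) + 1 then (1 : ℂ) else 0) ^ (i : ℕ)) * (∑ i : Fin N, H k i • (Matrix.of fun i j : Fin N => if (i : ℕ) = (j : ℕ) + 1 then (1 : ℂ) else 0)ᵀ ^ (i : ℕ)))) *ᵥ (Pi.single nt 1) ∈ Submodule.span ℂ ({w : Fin N → ℂ | ∃ (k : Fin p) (i : ℕ), 1 ≤ i ∧ i ≤ j ∧ w = (Matrix.of fun i j : Fin N => if (i : ℕ) = (j : ℕ) + 1 then (1 : ℂ) else 0)ᵀ ^ i *ᵥ (fun n => G₀ n k)} ∪ {w : Fin N → ℂ | ∃ n : Fin N, N ≤ (n : ℕ) + j ∧ w = Pi.single n 1}) := by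
  intro N p j G₀ H nd nt hj _h1 hKe
  cases N with
  | zero => exact nd.elim0
  | succ n =>
  set Z : Matrix (Fin (n + 1)) (Fin (n + 1)) ℂ :=
    Matrix.of fun i j : Fin (n + 1) => if (i : ℕ) = (j : ℕ) + 1 then (1 : ℂ) else 0 with hZ
  set K : Matrix (Fin (n + 1)) (Fin (n + 1)) ℂ :=
    ∑ k : Fin p, ((∑ i : Fin (n + 1), G₀ i k • Z ^ (i : ℕ)) *
      (∑ i : Fin (n + 1), H k i • Zᵀ ^ (i : ℕ))) with hK
  -- the abstract hypotheses
  have hKv : ∀ v, K *ᵥ v = ∑ k : Fin p, (∑ i : Fin (n + 1), G₀ i k • Z ^ (i : ℕ)) *ᵥ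
      ((∑ i : Fin (n + 1), H k i • Zᵀ ^ (i : ℕ)) *ᵥ v) := by
    intro v
    rw [hK, Matrix.sum_mulVec]
    simp only [Matrix.mulVec_mulVec]
  have hL : ∀ (k : Fin p) v, Z *ᵥ ((∑ i : Fin (n + 1), G₀ i k • Z ^ (i : ℕ)) *ᵥ v) =
      (∑ i : Fin (n + 1), G₀ i k • Z ^ (i : ℕ)) *ᵥ (Z *ᵥ v) := by
    intro k v
    rw [Matrix.mulVec_mulVec, Matrix.mulVec_mulVec,
      (hclR_kc_commute_sum_smul_pow Finset.univ Z (fun i => G₀ i k) (fun i => (i : ℕ))).eq]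
  have hU : ∀ (k : Fin p) v, (∑ i : Fin (n + 1), H k i • Zᵀ ^ (i : ℕ)) *ᵥ (Zᵀ *ᵥ v) =
      Zᵀ *ᵥ ((∑ i : Fin (n + 1), H k i • Zᵀ ^ (i : ℕ)) *ᵥ v) := by
    intro k v
    rw [Matrix.mulVec_mulVec, Matrix.mulVec_mulVec,
      (hclR_kc_commute_sum_smul_pow Finset.univ Zᵀ (fun i => H k i) (fun i => (i : ℕ))).eq]
  have hZZt : ∀ v : Fin (n + 1) → ℂ, Z *ᵥ (Zᵀ *ᵥ v) = v - v 0 • Pi.single 0 1 :=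
    hclR_kc_shift_shiftT_mulVec
  have hZtZ : ∀ v : Fin (n + 1) → ℂ,
      Zᵀ *ᵥ (Z *ᵥ v) = v - v (Fin.last n) • Pi.single (Fin.last n) 1 :=
    hclR_kc_shiftT_shift_mulVec
  clear _h1
  induction j generalizing nt with
  | zero =>
    have : nt = nd := Fin.ext (by simpa using hj)
    rw [this, hKe]
    exact Submodule.zero_mem _
  | succ j ih =>
    have hnd := nd.2
    set nt' : Fin (n + 1) := ⟨(nt : ℕ) + 1, by omega⟩ with hnt'
    have ih' := ih nt' (by simp only [hnt']; omega)
    have he : Zᵀ *ᵥ Pi.single nt' 1 = Pi.single nt 1 :=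
      hclR_kc_shiftT_mulVec_single_succ nt nt' (by simp only [hnt'])
    have hstep := hclR_kc_shiftDown_step Z K _ _ hKv hL hU hZZt hZtZ (Pi.single nt' 1)
    rw [he] at hstep
    rw [hstep]
    refine Submodule.add_mem _ (Submodule.sub_mem _ ?_ ?_) ?_
    · -- `Zᵀ` maps the generators at level `j` into the span at level `j + 1`
      have hle : Submodule.map (Matrix.mulVecLin Zᵀ)
          (Submodule.span ℂ ({w : Fin (n + 1) → ℂ | ∃ (k : Fin p) (i : ℕ), 1 ≤ i ∧ i ≤ j ∧
              w = Zᵀ ^ i *ᵥ (fun n => G₀ n k)} ∪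
            {w : Fin (n + 1) → ℂ | ∃ m : Fin (n + 1), n + 1 ≤ (m : ℕ) + j ∧ w = Pi.single m 1})) ≤
          Submodule.span ℂ ({w : Fin (n + 1) → ℂ | ∃ (k : Fin p) (i : ℕ), 1 ≤ i ∧ i ≤ j + 1 ∧
              w = Zᵀ ^ i *ᵥ (fun n => G₀ n k)} ∪
            {w : Fin (n + 1) → ℂ | ∃ m : Fin (n + 1), n + 1 ≤ (m : ℕ) + (j + 1) ∧
              w = Pi.single m 1}) := by
        rw [Submodule.map_span_le]
        rintro _ (⟨k, i, h1i, hij, rfl⟩ | ⟨m, hm, rfl⟩)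
        · refine Submodule.subset_span (Or.inl ⟨k, i + 1, by omega, by omega, ?_⟩)
          rw [Matrix.mulVecLin_apply, Matrix.mulVec_mulVec, ← pow_succ']
        · rw [Matrix.mulVecLin_apply]
          by_cases hm0 : (m : ℕ) = 0
          · rw [hclR_kc_shiftT_mulVec_single_zero m hm0]
            exact Submodule.zero_mem _
          · have hm1 : (m : ℕ) - 1 < n + 1 := by omega
            rw [hclR_kc_shiftT_mulVec_single_succ ⟨(m : ℕ) - 1, hm1⟩ m (by simp only; omega)]
            exact Submodule.subset_span (Or.inr ⟨⟨(m : ℕ) - 1, hm1⟩, by simp only; omega, rfl⟩)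
      exact hle (Submodule.mem_map_of_mem ih')
    · refine Submodule.sum_mem _ fun k _ => Submodule.smul_mem _ _ (Submodule.subset_span
        (Or.inl ⟨k, 1, le_rfl, by omega, ?_⟩))
      rw [hclR_kc_lowerToeplitz_mulVec_e0, pow_one]
    · exact Submodule.smul_mem _ _ (Submodule.subset_span
        (Or.inr ⟨Fin.last n, by simp only [Fin.val_last]; omega, rfl⟩))

end Summit.MatrixMultiplication.MatrixMultiplication.Theorems
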